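import Mathlib
import Summits.KontsevichZagierPeriods.Zeta5Search.RecordCellCAtlas
import HarnessLib

/-!
# ζ(5) search — the CLASS ATLAS of the record ray at the primes `8.2n < p ≤ 8.5n` (census g11 cells C′ ∪ C″; gen-2 g9's "zero" cell)

Cell `pub-zeta5` (HONEST FRAMING: systematic search; no irrationality claim unless certified), P1 prover seat generation 6.
Next to cell C, census g11's atlas (`STRUCTURE §15.4`) has the cells C′ = (25/3, 17/2) and C″ = (41/5, 25/3) (weights 0.167, 0.133;
truth `v_p(Cas₇) ≥ −11` resp. `−10` against the tree's THEOREM LB `−13`); gen-2 g9's all-`n` atlas (REPORT §10) explains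
θ ∈ (41/5, 17/2] as a "zero" cell: the ONLY minimal classes (`E = −8`) are the centre-free four-point palindromes `(1,−5,−5,1)`, whose
conjugate pairs cancel in BOTH leading digits (`DoubleDropBonus`), so `v_p(W) ≥ −4`, `v_p(V) ≥ −7` and `v_p(Cas₇) ≥ −11 = casLB + 2`.
This file is the arithmetic for `41n < 5p`, `2p ≤ 17n`: classes of four or five points (`classSet_bRecZ`), the minimal set
`ZS = {16n ≤ x+p, x+2p ≤ 25n, 41n < x+4p, 2x+3p ≠ 41n}` with its net exponents for `b(n)` and `b(n)+e₇` (conjugation `x ↦ 41n − (x+3p)`),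
and `E_x ≥ −7` for EVERY other class (`classExpZ_ge_of_notMin`).  Exact arithmetic on the ray; cross-checked at the 7 primes of the cell
with `n ≤ 13` (`code/p1/g6/cellCz_check.py`).  Nothing about irrationality.
-/

open Finset

namespace Summit.KontsevichZagierPeriods.Zeta5Search.CellC

open Summit.KontsevichZagierPeriods.Zeta5Search.ClusterValuation
open Summit.KontsevichZagierPeriods.Zeta5Search.CasoratianValuation (shift)
open Summit.KontsevichZagierPeriods.Zeta5Search.BigPrime (block shift_zero)
open Summit.KontsevichZagierPeriods.Zeta5Search.CellA
open Summit.KontsevichZagierPeriods.Zeta5Search.CellD (dep7_well netExp_centre sum_five')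

/-! ### §1 The residue classes for `41n < 5p` -/

section Classes

/-- **The class of `x < p`** for `8.2n < p ≤ 8.5n`: `{x, …, x+4p}` if `x + 4p ≤ 41n`, else `{x, x+p, x+2p, x+3p}`. -/
theorem classSet_bRecZ {n p : ℕ} (hp : 41 * n < 5 * p) (hp' : 2 * p ≤ 17 * n) {x : ℕ} (hx : x < p) :
    classSet (bRec n) p x = if x + 4 * p ≤ 41 * n then {x, x + p, x + 2 * p, x + 3 * p, x + 4 * p}
      else {x, x + p, x + 2 * p, x + 3 * p} := by
  ext s
  rw [mem_classSet_iff, bRec_zero_toNat]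
  have key : (s ≤ 41 * n ∧ (p : ℤ) ∣ (s : ℤ) - x) ↔
      (s = x ∨ s = x + p ∨ s = x + 2 * p ∨ s = x + 3 * p ∨ (s = x + 4 * p ∧ x + 4 * p ≤ 41 * n)) := by
    constructor
    · rintro ⟨hs, k, hk⟩
      have hk0 : 0 ≤ k := by
        by_contra hneg
        push Not at hneg
        have : (p : ℤ) * k ≤ (p : ℤ) * (-1) := mul_le_mul_of_nonneg_left (by omega) (by omega)
        omega
      have hk5 : k < 5 := by
        by_contra hge
        push Not at hge
        have : (p : ℤ) * 5 ≤ (p : ℤ) * k := mul_le_mul_of_nonneg_left hge (by omega)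
        omega
      interval_cases k <;> omega
    · rintro (rfl | rfl | rfl | rfl | ⟨rfl, h⟩)
      · exact ⟨by omega, 0, by ring⟩
      · exact ⟨by omega, 1, by push_cast; ring⟩
      · exact ⟨by omega, 2, by push_cast; ring⟩
      · exact ⟨by omega, 3, by push_cast; ring⟩
      · exact ⟨h, 4, by push_cast; ring⟩
  rw [key]
  split_ifs with h5
  · simp only [mem_insert, mem_singleton]; tauto
  · simp only [mem_insert, mem_singleton]
    constructor
    · rintro (h | h | h | h | ⟨h, h'⟩)
      · exact Or.inl h
      · exact Or.inr (Or.inl h)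
      · exact Or.inr (Or.inr (Or.inl h))
      · exact Or.inr (Or.inr (Or.inr h))
      · exact absurd h' h5
    · rintro (h | h | h | h)
      · exact Or.inl h
      · exact Or.inr (Or.inl h)
      · exact Or.inr (Or.inr (Or.inl h))
      · exact Or.inr (Or.inr (Or.inr (Or.inl h)))

/-- Four-point classes: the exponent sum bounds the class exponent from below. -/
theorem classExpZ_ge_four {n p : ℕ} (hp : 41 * n < 5 * p) (hp' : 2 * p ≤ 17 * n) {x : ℕ} (hx : x < p)
    (h5 : ¬ x + 4 * p ≤ 41 * n) :
    netExp (bRec n) x + netExp (bRec n) (x + p) + netExp (bRec n) (x + 2 * p) + netExp (bRec n) (x + 3 * p) ≤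
      classExp (bRec n) p x := by
  refine le_trans (le_of_eq ?_) (classExp_ge_sum _ _ _)
  rw [classSet_bRecZ hp hp' hx, if_neg h5, sum_four' (by omega)]

/-- Five-point classes: the exponent sum bounds the class exponent from below. -/
theorem classExpZ_ge_five {n p : ℕ} (hp : 41 * n < 5 * p) (hp' : 2 * p ≤ 17 * n) {x : ℕ} (hx : x < p)
    (h5 : x + 4 * p ≤ 41 * n) :
    netExp (bRec n) x + netExp (bRec n) (x + p) + netExp (bRec n) (x + 2 * p) + netExp (bRec n) (x + 3 * p) +
      netExp (bRec n) (x + 4 * p) ≤ classExp (bRec n) p x := by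
  refine le_trans (le_of_eq ?_) (classExp_ge_sum _ _ _)
  rw [classSet_bRecZ hp hp' hx, if_pos h5, sum_five' (by omega)]

/-- Four-point SELF-CONJUGATE classes (`2x + 3p = 41n`, odd `p`): exponent sum plus the centre term `1`. -/
theorem classExpZ_four_centre {n p : ℕ} (hp : 41 * n < 5 * p) (hp' : 2 * p ≤ 17 * n) {x : ℕ} (hx : x < p) (hodd : ¬ 2 ∣ p)
    (hc : 2 * x + 3 * p = 41 * n) :
    classExp (bRec n) p x = netExp (bRec n) x + netExp (bRec n) (x + p) + netExp (bRec n) (x + 2 * p) +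
      netExp (bRec n) (x + 3 * p) + 1 := by
  have hcen : ¬ (2 : ℤ) ∣ bRec n 0 ∧ CentreIn (bRec n) p x := by
    rw [CentreIn, bRec_zero]
    refine ⟨fun h2 => hodd ?_, ⟨-3, by omega⟩⟩
    have h2' : (2 : ℤ) ∣ (p : ℤ) := by
      have e : (41 * (n : ℤ)) = 2 * ((x : ℤ) + p) + p := by omega
      rw [e] at h2
      exact (dvd_add_right (dvd_mul_right 2 _)).1 h2
    exact Int.natCast_dvd_natCast.1 h2'
  unfold classExp
  rw [if_pos hcen, classSet_bRecZ hp hp' hx, if_neg (by omega), sum_four' (by omega)]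

/-- **Centre-freeness** on the cell: `2x + 3p ≠ 41n` and `2x + 4p ≠ 41n` exclude the centre residue. -/
theorem not_centreInZ {n p : ℕ} (hp : 41 * n < 5 * p) (hp' : 2 * p ≤ 17 * n) {x : ℕ} (hx : x < p)
    (h3 : 2 * x + 3 * p ≠ 41 * n) (h4 : 2 * x + 4 * p ≠ 41 * n) : ¬ CentreIn (bRec n) p x := by
  rintro ⟨k, hk⟩
  rw [bRec_zero] at hk
  have hk1 : -5 < k := by
    by_contra hle
    push Not at hle
    have : (p : ℤ) * k ≤ (p : ℤ) * (-5) := mul_le_mul_of_nonneg_left hle (by omega)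
    omega
  have hk2 : k < -2 := by
    by_contra hge
    push Not at hge
    have : (p : ℤ) * (-2) ≤ (p : ℤ) * k := mul_le_mul_of_nonneg_left hge (by omega)
    omega
  interval_cases k <;> omega

end Classes

/-! ### §2 The minimal classes: the centre-free four-point palindromes `(1,−5,−5,1)` -/

/-- `ZS = {16n ≤ x+p, x+2p ≤ 25n, 41n < x+4p, 2x+3p ≠ 41n}`. -/
def ZS (n p : ℕ) : Finset ℕ :=
  (range p).filter fun x => 16 * n ≤ x + p ∧ x + 2 * p ≤ 25 * n ∧ 41 * n < x + 4 * p ∧ 2 * x + 3 * p ≠ 41 * n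

/-- Membership in `ZS`. -/
theorem mem_zs {n p x : ℕ} :
    x ∈ ZS n p ↔ x < p ∧ 16 * n ≤ x + p ∧ x + 2 * p ≤ 25 * n ∧ 41 * n < x + 4 * p ∧ 2 * x + 3 * p ≠ 41 * n := by
  simp [ZS]

/-- `ZS ⊆ range p`. -/
theorem zs_subset (n p : ℕ) : ZS n p ⊆ range p := fun _ hx => mem_range.2 (mem_zs.1 hx).1

section MinExps

variable {n p : ℕ} (hp : 41 * n < 5 * p) (hp' : 2 * p ≤ 17 * n)

include hp hp' in
/-- Net exponents of a class of `ZS`: `(1,−5,−5,1)`, also for `b(n) + e₇`; four points; centre-free. -/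
theorem netExp_zs {x : ℕ} (hx : x ∈ ZS n p) :
    (netExp (bRec n) x = 1 ∧ netExp (bRec n) (x + p) = -5 ∧ netExp (bRec n) (x + 2 * p) = -5 ∧
      netExp (bRec n) (x + 3 * p) = 1) ∧
    (netExp (shift (bRec n) 7) x = 1 ∧ netExp (shift (bRec n) 7) (x + p) = -5 ∧
      netExp (shift (bRec n) 7) (x + 2 * p) = -5 ∧ netExp (shift (bRec n) 7) (x + 3 * p) = 1) ∧
    x < p ∧ x + 3 * p ≤ 41 * n ∧ 41 * n < x + 3 * p + p ∧ 2 * x + 3 * p ≠ 41 * n ∧ 2 * x + 4 * p ≠ 41 * n := by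
  rw [mem_zs] at hx
  obtain ⟨hxp, h16, h25, h41, hself⟩ := hx
  have e0 : netExp (bRec n) x = 1 := by
    rw [netExp_bRec_of_ne n x (by omega), dep7_low (by omega)]; norm_num
  have e1 : netExp (bRec n) (x + p) = -5 := by
    rw [netExp_bRec_of_ne n (x + p) (by omega), dep7_lower (by norm_num : 6 ≤ 7) (by omega) (by omega)]; norm_num
  have e2 : netExp (bRec n) (x + 2 * p) = -5 := by
    rw [netExp_bRec_of_ne n (x + 2 * p) (by omega), dep7_upper (by norm_num : 6 ≤ 7) (by omega) (by omega)]; norm_num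
  have e3 : netExp (bRec n) (x + 3 * p) = 1 := by
    rw [netExp_bRec_of_ne n (x + 3 * p) (by omega), dep7_high (by omega)]; norm_num
  refine ⟨⟨e0, e1, e2, e3⟩, ⟨?_, ?_, ?_, ?_⟩, hxp, by omega, by omega, hself, by omega⟩
  · rw [netExp_shift7 n x (by omega) (by omega), e0]
  · rw [netExp_shift7 n (x + p) (by omega) (by omega), e1]
  · rw [netExp_shift7 n (x + 2 * p) (by omega) (by omega), e2]
  · rw [netExp_shift7 n (x + 3 * p) (by omega) (by omega), e3]

end MinExps

/-- The conjugation `x ↦ 41n − (x + 3p)` maps `ZS` onto itself. -/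
theorem conj_mem_zs {n p x : ℕ} (hp : 41 * n < 5 * p) (hx : x ∈ ZS n p) : 41 * n - (x + 3 * p) ∈ ZS n p := by
  rw [mem_zs] at hx ⊢; omega

/-! ### §3 Every other class has `E_x ≥ −7` -/

section NotMin

variable {n p x : ℕ} (hp : 41 * n < 5 * p) (hp' : 2 * p ≤ 17 * n) (hx : x < p)

/-- Regions `x + p < 15n` of the zero cell: `E_x ≥ −7`. -/
theorem classExpZ_low {n p x : ℕ} (hp : 41 * n < 5 * p) (hp' : 2 * p ≤ 17 * n) (hx : x < p) (h15 : x + p < 15 * n) :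
    -7 ≤ classExp (bRec n) p x := by
  have e0 : netExp (bRec n) x = 1 := by
    rw [netExp_bRec_of_ne n x (by omega), dep7_low (by omega)]; norm_num
  have a0 : x + p < 11 * n → netExp (bRec n) (x + p) = 1 := fun h => by
    rw [netExp_bRec_of_ne n (x + p) (by omega), dep7_low (by omega)]; norm_num
  have a1 : 11 * n ≤ x + p → x + p < 12 * n → netExp (bRec n) (x + p) = 0 := fun h h' => by
    rw [netExp_bRec_of_ne n (x + p) (by omega), dep7_lower (by norm_num : 1 ≤ 7) (by omega) (by omega)]; norm_num
  have a2 : 12 * n ≤ x + p → x + p < 13 * n → netExp (bRec n) (x + p) = -1 := fun h h' => by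
    rw [netExp_bRec_of_ne n (x + p) (by omega), dep7_lower (by norm_num : 2 ≤ 7) (by omega) (by omega)]; norm_num
  have a3 : 13 * n ≤ x + p → x + p < 14 * n → netExp (bRec n) (x + p) = -2 := fun h h' => by
    rw [netExp_bRec_of_ne n (x + p) (by omega), dep7_lower (by norm_num : 3 ≤ 7) (by omega) (by omega)]; norm_num
  have a4 : 14 * n ≤ x + p → netExp (bRec n) (x + p) = -3 := fun h => by
    rw [netExp_bRec_of_ne n (x + p) (by omega), dep7_lower (by norm_num : 4 ≤ 7) (by omega) (by omega)]; norm_num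
  have b0 : x + 2 * p < 17 * n → netExp (bRec n) (x + 2 * p) = -5 := fun h => by
    rw [netExp_bRec_of_ne n (x + 2 * p) (by omega), dep7_lower (by norm_num : 6 ≤ 7) (by omega) (by omega)]; norm_num
  have b1 : 17 * n ≤ x + 2 * p → 2 * (x + 2 * p) ≠ 41 * n → netExp (bRec n) (x + 2 * p) = -6 := fun h h' => by
    rw [netExp_bRec_of_ne n (x + 2 * p) (by omega), dep7_well (by omega) (by omega)]; norm_num
  have b2 : 2 * (x + 2 * p) = 41 * n → netExp (bRec n) (x + 2 * p) = -5 := fun h => netExp_centre h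
  have c0 : x + 3 * p ≤ 25 * n → netExp (bRec n) (x + 3 * p) = -5 := fun h => by
    rw [netExp_bRec_of_ne n (x + 3 * p) (by omega), dep7_upper (by norm_num : 6 ≤ 7) (by omega) (by omega)]; norm_num
  have c1 : 25 * n < x + 3 * p → x + 3 * p ≤ 26 * n → netExp (bRec n) (x + 3 * p) = -4 := fun h h' => by
    rw [netExp_bRec_of_ne n (x + 3 * p) (by omega), dep7_upper (by norm_num : 5 ≤ 7) (by omega) (by omega)]; norm_num
  have c2 : 26 * n < x + 3 * p → x + 3 * p ≤ 27 * n → netExp (bRec n) (x + 3 * p) = -3 := fun h h' => by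
    rw [netExp_bRec_of_ne n (x + 3 * p) (by omega), dep7_upper (by norm_num : 4 ≤ 7) (by omega) (by omega)]; norm_num
  have c3 : 27 * n < x + 3 * p → x + 3 * p ≤ 28 * n → netExp (bRec n) (x + 3 * p) = -2 := fun h h' => by
    rw [netExp_bRec_of_ne n (x + 3 * p) (by omega), dep7_upper (by norm_num : 3 ≤ 7) (by omega) (by omega)]; norm_num
  have c4 : 28 * n < x + 3 * p → x + 3 * p ≤ 29 * n → netExp (bRec n) (x + 3 * p) = -1 := fun h h' => by
    rw [netExp_bRec_of_ne n (x + 3 * p) (by omega), dep7_upper (by norm_num : 2 ≤ 7) (by omega) (by omega)]; norm_num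
  have c5 : 29 * n < x + 3 * p → x + 3 * p ≤ 30 * n → netExp (bRec n) (x + 3 * p) = 0 := fun h h' => by
    rw [netExp_bRec_of_ne n (x + 3 * p) (by omega), dep7_upper (by norm_num : 1 ≤ 7) (by omega) (by omega)]; norm_num
  have c6 : 30 * n < x + 3 * p → netExp (bRec n) (x + 3 * p) = 1 := fun h => by
    rw [netExp_bRec_of_ne n (x + 3 * p) (by omega), dep7_high (by omega)]; norm_num
  have d1 : netExp (bRec n) (x + 4 * p) = 1 := by
    rw [netExp_bRec_of_ne n (x + 4 * p) (by omega), dep7_high (by omega)]; norm_num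
  by_cases h5 : x + 4 * p ≤ 41 * n
  · have hE := classExpZ_ge_five hp hp' hx h5
    omega
  · have hE := classExpZ_ge_four hp hp' hx h5
    omega

include hp hp' hx in
/-- Region `15n ≤ x + p < 16n`: `(1, −4, −6|−5, 1 [,1])`; the fifth point is present when `e₂ = −6` (`2p ≤ 17n`). -/
theorem classExpZ_R5 (h15 : 15 * n ≤ x + p) (h16 : x + p < 16 * n) : -7 ≤ classExp (bRec n) p x := by
  have e0 : netExp (bRec n) x = 1 := by
    rw [netExp_bRec_of_ne n x (by omega), dep7_low (by omega)]; norm_num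
  have e1 : netExp (bRec n) (x + p) = -4 := by
    rw [netExp_bRec_of_ne n (x + p) (by omega), dep7_lower (by norm_num : 5 ≤ 7) (by omega) (by omega)]; norm_num
  have b1 : x + 2 * p ≤ 24 * n → netExp (bRec n) (x + 2 * p) = -6 := fun h => by
    rw [netExp_bRec_of_ne n (x + 2 * p) (by omega), dep7_well (by omega) (by omega)]; norm_num
  have b2 : 24 * n < x + 2 * p → netExp (bRec n) (x + 2 * p) = -5 := fun h => by
    rw [netExp_bRec_of_ne n (x + 2 * p) (by omega), dep7_upper (by norm_num : 6 ≤ 7) (by omega) (by omega)]; norm_num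
  have e3 : netExp (bRec n) (x + 3 * p) = 1 := by
    rw [netExp_bRec_of_ne n (x + 3 * p) (by omega), dep7_high (by omega)]; norm_num
  by_cases h5 : x + 4 * p ≤ 41 * n
  · have e4 : netExp (bRec n) (x + 4 * p) = 1 := by
      rw [netExp_bRec_of_ne n (x + 4 * p) (by omega), dep7_high (by omega)]; norm_num
    have hE := classExpZ_ge_five hp hp' hx h5
    omega
  · have hE := classExpZ_ge_four hp hp' hx h5
    omega

include hp hp' hx in
/-- Region `16n ≤ x + p` outside `ZS`: four or five points `(1, −5, −5|−4, 1 [,1])`; `E = −8` only on `ZS`, and the self-conjugate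
classes `2x + 3p = 41n` get `+1` from the odd centre. -/
theorem classExpZ_R6 (hodd : ¬ 2 ∣ p) (h16 : 16 * n ≤ x + p)
    (hS : 25 * n < x + 2 * p ∨ x + 4 * p ≤ 41 * n ∨ 2 * x + 3 * p = 41 * n) : -7 ≤ classExp (bRec n) p x := by
  have e0 : netExp (bRec n) x = 1 := by
    rw [netExp_bRec_of_ne n x (by omega), dep7_low (by omega)]; norm_num
  have e1 : netExp (bRec n) (x + p) = -5 := by
    rw [netExp_bRec_of_ne n (x + p) (by omega), dep7_lower (by norm_num : 6 ≤ 7) (by omega) (by omega)]; norm_num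
  have b1 : x + 2 * p ≤ 25 * n → netExp (bRec n) (x + 2 * p) = -5 := fun h => by
    rw [netExp_bRec_of_ne n (x + 2 * p) (by omega), dep7_upper (by norm_num : 6 ≤ 7) (by omega) (by omega)]; norm_num
  have b2 : 25 * n < x + 2 * p → netExp (bRec n) (x + 2 * p) = -4 := fun h => by
    rw [netExp_bRec_of_ne n (x + 2 * p) (by omega), dep7_upper (by norm_num : 5 ≤ 7) (by omega) (by omega)]; norm_num
  have e3 : netExp (bRec n) (x + 3 * p) = 1 := by
    rw [netExp_bRec_of_ne n (x + 3 * p) (by omega), dep7_high (by omega)]; norm_num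
  by_cases h5 : x + 4 * p ≤ 41 * n
  · have e4 : netExp (bRec n) (x + 4 * p) = 1 := by
      rw [netExp_bRec_of_ne n (x + 4 * p) (by omega), dep7_high (by omega)]; norm_num
    have hE := classExpZ_ge_five hp hp' hx h5
    omega
  · have hE := classExpZ_ge_four hp hp' hx h5
    have hEc : 2 * x + 3 * p = 41 * n → classExp (bRec n) p x = netExp (bRec n) x + netExp (bRec n) (x + p) +
        netExp (bRec n) (x + 2 * p) + netExp (bRec n) (x + 3 * p) + 1 := fun h => classExpZ_four_centre hp hp' hx hodd h
    omega

include hp hp' hx in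
/-- **THE NON-MINIMAL CLASSES**: for `x < p` outside `ZS`, `E_x(b(n), p) ≥ −7`. -/
theorem classExpZ_ge_of_notMin (hodd : ¬ 2 ∣ p) (h1 : x ∉ ZS n p) : -7 ≤ classExp (bRec n) p x := by
  rw [mem_zs] at h1
  by_cases h15 : x + p < 15 * n
  · exact classExpZ_low hp hp' hx h15
  push Not at h15
  by_cases h16 : x + p < 16 * n
  · exact classExpZ_R5 hp hp' hx h15 h16
  push Not at h16
  refine classExpZ_R6 hp hp' hx hodd h16 ?_
  by_contra hc; push Not at hc; exact h1 ⟨hx, h16, hc.1, by omega, hc.2.2⟩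

end NotMin

end Summit.KontsevichZagierPeriods.Zeta5Search.CellC
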